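import Summits.QuantumFields.YangMills.Theorems.UV3PinnedStepOrganOfTopPartialIteratesKnit
import Summits.QuantumFields.YangMills.Theorems.UV3UnitEnvelopeLinOfPartialIterates
import Summits.QuantumFields.YangMills.Theorems.UnitScaleTiltHistoryTailOfPackagePartialIterates
import Summits.QuantumFields.YangMills.Theorems.UnitScaleTiltHistoryTailOfPackageMassEnvelope
import HarnessLib

/-!
# R3 (cell `ym3-torus`, YM₃ on T³ — a ladder RUNG, NOT d = 4, NOT infinite volume, NOT a mass gap, NOT the Clay problem) —
# **THE 19936 CRUX `UnitScaleTilt.HistoryTailL` FROM THE GUARDED v1 (α) SOCKET, THE POLYMER FIELDS, THE MAIN-TERM ROW AND THE TOP-LEVEL KINEMATIC ROW hTop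
# «EVERY SEGMENT OF THE FAMILY'S BLOCK AVERAGING ENDING AT THE UNIT TORUS PUSHES HAAR TO AT MOST `e^{c}`·HAAR» — the v5-candidate face (★★OWNER WORD 68)**

Width seat `ym-ust-19936-w3` g19 on crux `stmt-QuantumFields-19936` (`--supports`, helper; THEOREMS ONLY, 0 `def`, 0 `sorry`; CONDITIONAL face, closes nothing).
The hTop twin of LEAD `ym-ust-19936-w1` g11's K-22 `UV3UnitEnvelopeLinOfPartialIterates` ∕ K-23 `UnitScaleTiltHistoryTailOfPackagePartialIterates` (the same chain over
the all-levels letter (a)′∀), with the (α) socket GUARDED as in `ym-ust-19936-w8` g11's face of record `UnitScaleTiltHistoryTailOfPackageMassEnvelope` (★★OWNER RULING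
№38: `AlphaInputsT3AC L` is false for `L ≤ 1`, so the socket reads `∀ L, 1 < L → AlphaInputsT3AC L`).

THE ROW.  hTop(F) : `∃ c ≥ 0, ∀ K j n, j + n = K → (dU_j^{(K)})∘(iterFrom (avT3 F K) j n)⁻¹ ≤ e^{c}·dU_{j+n}^{(K)}` — one measure inequality per segment of the
pinned block averaging `avT3 F K` (= `blockAvg ℰp` in range) ENDING AT THE UNIT TORUS (`(2L^m)³` sites for every run); nothing is asked at the levels `k < K`
whose volume `(2L^{m+K−k})³` grows with `K` (the all-levels (a)′∀ implies hTop, ✓`UV3PinnedStepOrganOfTopPartialIterates.topHaarPushforward_of_partialIterates`).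
From hTop the parent files give the LINEAR mass envelope `m_K(r,·) ≤ (K+1)·e^{A₁}` a.e. for EVERY history (the trivial one included — so no separate hTriv
row) and the S organ row `hSii` (KNIT).  THIS FILE: §1 the U side FACTORED THROUGH THE LINEAR ENVELOPE (so that (a)′∀ and hTop — or any future supplier
of the envelope — instantiate by one line): `hlfLin` (K-22 §1 `top_le_of_massEnvelopeAll` by name) → (U″) with slack `(K+1)` (K-22 §3 `ae_emlDensity_top_le_of_rows_ae_at`)
→ the unit envelope with slack `ρ_K ≤ (K+1)·e^{Cl'}·Z_K` a.e. (K-22 §4 `unitEnvelope_of_halves_lin`), then at hTop; §2 the `∀ L` letters with the GUARDED socket, the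
pinned height tail `hP′` through K-23's door `pinnedHeightTail_of_lin'` (the factor `K + 1` absorbed by `K + 1 ≤ (m+2)·β_{K−j}` at the constrained heights), and
★★★★ `historyTailL_of_package_of_topHaarPushforward_of_main (hpkg)(π)(hMain)(hTop) : UnitScaleTilt.HistoryTailL` — ONE `exact` through the LEAD socket ✓p748552.
**By kernel: `HistoryTailL` ⟸ guarded socket ∧ π ∧ hMain ∧ hTop** — FOUR displayed rows, no hJ ∕ hTriv ∕ hSii ∕ hlf ∕ (a)′∀.

CONTENTS.
* §1 ★★ `AlphaInputsT3AC.Of.hlfLin_of_linMassEnvelopeAll`, ★★ `…Of.ae_emlDensity_top_le_lin_of_hlfLin`, ★★ `…Of.unitEnvelopeLin_of_hlfLin_of_main` (per family, generic in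
  the envelope's origin); ★★★ `…Of.hlfLin_of_topHaarPushforward`, ★★★ `…Of.unitEnvelopeLin_of_topHaarPushforward_of_main`.
* §2 `topHaarPushforward_of_topBlockAvgPushforward` (the letter with `blockAvg ℰp` spelled out implies hTop); ★★ `unitEnvelopeLin_forall_of_topHaarPushforward_of_main`
  (guarded socket); ★★★ `pinnedHeightTail_of_package_of_topHaarPushforward_of_main` (`hP′` VERBATIM); ★★★★ `historyTailL_of_package_of_topHaarPushforward_of_main`;
  ★★★ `historyTailL_of_package_of_topBlockAvgPushforward_of_main` (the same with the cruxes' `blockAvg ℰp` family spelled out).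

HONEST SCOPE.  CONDITIONAL faces ∕ bookkeeping over landed theorems; hTop, `hMain`, `hpkg` are DISPLAYED hypotheses, NOT proved (hTop is OPEN for the tree's
`blockAvg ℰp`: the N08 loop part; `hpkg` = the UV3 node's (α) input package, XXL; `hMain` = the EX lane); `π` is a parameter.  Nothing of `stub_pinnedStep` ∕
`stub_unitEnvelope` (the registered K-uniform letters), `HistoryTailL` (19936) unconditionally, the rung `YM3TorusSU2`, any continuum limit, d = 4, infinite volume, a mass gap
or Clay is proved here.  YM₃ on T³ is rung R3 of the ladder, not the Clay problem.

References: T. Bałaban, Commun. Math. Phys. **102** (1985) 255–275 [Balaban1985UV3] ((2) p. 256, (5)–(7) pp. 256–257, (41) p. 266, (46)–(47) p. 267,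
(67)–(71) p. 273, pp. 273–274); T. Bałaban, Commun. Math. Phys. **98** (1985) 17–51 [Balaban1985Averaging] ((15) p. 19); T. Bałaban, Commun. Math. Phys.
**109** (1987) 249–301 [Balaban1987RG1] ((0.4), (0.11) p. 253).
-/

set_option autoImplicit false

noncomputable section

namespace Summit.QuantumFields.YangMills.Theorems.UnitScaleTiltHistoryTailOfPackageTopPartialIterates

open scoped BigOperators ENNReal
open MeasureTheory
open Literature.MathematicalPhysics.QuantumFieldTheory.Balaban1983to89
open Literature.MathematicalPhysics.QuantumFieldTheory.Balaban1983to89.T4AvgSensitivity (iterFrom)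
open Literature.MathematicalPhysics.QuantumFieldTheory.Balaban1983to89.T3ContinuumYM3Torus
open Literature.MathematicalPhysics.QuantumFieldTheory.Balaban1983to89.T3UnitScaleTilt
open Literature.MathematicalPhysics.QuantumFieldTheory.Balaban1983to89.T3UnitLawDensityEML
open Literature.MathematicalPhysics.QuantumFieldTheory.Balaban1983to89.T3RestrictedUnitDensity
open Literature.MathematicalPhysics.QuantumFieldTheory.Balaban1983to89.T3CruxEstimates
open Literature.MathematicalPhysics.QuantumFieldTheory.Balaban1983to89.T3AlphaInputsAC
open Literature.MathematicalPhysics.QuantumFieldTheory.Balaban1983to89.Missing (partitionFn)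
open Literature.MathematicalPhysics.QuantumFieldTheory.Balaban1985CMP102
open Literature.MathematicalPhysics.QuantumFieldTheory.Balaban1985CMP102.Setting
open Summit.QuantumFields.Balaban3D.Carriers
open Summit.QuantumFields.Balaban3D.Proofs.Primitives
open Summit.QuantumFields.Balaban3D.Proofs.TowerAC
open Summit.QuantumFields.Balaban3D.Proofs.StandardAC
open Summit.QuantumFields.Balaban3D.Proofs.InputsAC
open Summit.QuantumFields.YangMills.Theorems.UV3PinnedStepKnitOfPackage (hPinA_of_pinnedLF)
open Summit.QuantumFields.YangMills.Theorems.UV3PinnedStepOrganOfTopPartialIterates (iterFrom_avT3_eq_iterFrom_blockAvg)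
open Summit.QuantumFields.YangMills.Theorems.UV3PinnedStepOrganOfTopPartialIteratesKnit (hSii_forall_of_topHaarPushforward)
open Summit.QuantumFields.YangMills.Theorems.UV3UnitEnvelopeLinOfPartialIterates
  (top_le_of_massEnvelopeAll ae_emlDensity_top_le_of_rows_ae_at unitEnvelope_of_halves_lin)
open Summit.QuantumFields.YangMills.Theorems.UnitScaleTiltHistoryTailOfPackagePartialIterates (pinnedHeightTail_of_lin')
open Summit.QuantumFields.YangMills.Theorems.UnitScaleTiltHistoryTailOfPackageMassEnvelope (stub_pinnedStepV3_of_package_of_purePinTop_of_main')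
open Summit.QuantumFields.YangMills.Theorems.UnitScaleTiltHistoryTailOfPinnedHeightTailFreeRate (historyTailL_of_pinnedHeightTail_freeRate)

/-! ## §1 The U side through the linear mass envelope, then at hTop -/

section PerFamily

variable {F : T3Family} {𝔠 : AlphaConsts F.L (suGroupModel 2).N}
  (h : AlphaInputsT3AC.Of F 𝔠) (γ : ℝ) (hγ : 0 < γ) (hγ1 : γ ≤ (min 𝔠.gamma0 1) ^ 2) (π : AlphaInputsT3AC.PolymerT3 F)

/-- ★★ **THE TOP-LEVEL UN-PINNED LEAF WITH LINEAR SLACK FROM A LINEAR MASS ENVELOPE ON EVERY HISTORY**: if `m_K(r,·) ≤ (K+1)·e^{A₁}` `dV_K`-a.e. for every run and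
every history (the trivial one included), then `LF_K(W)[h ↦ e^{−mainT + Zterm}] ≤ (K+1)·exp(A₁ + (3∕ℓ)(2L^m)³)` a.e. — K-22 §1 ✓`top_le_of_massEnvelopeAll` gathered over the
finitely many histories (`LF = Σ_r m_r·e^{Φ(r)}` by `rfl`); generic in where the envelope comes from ((a)′∀ via K-21, hTop via the parent file, or a future supplier).
[cite: Balaban1985UV3, (41) p.266, (5) p.257, pp.273–274] -/
theorem _root_.Summit.QuantumFields.YangMills.Theorems.AlphaInputsT3AC.Of.hlfLin_of_linMassEnvelopeAll
    (hEnv : ∃ A₁ : ℝ, ∀ (K : ℕ) (r : Hist (F.P K) K),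
      ∀ᵐ W ∂(fieldMeasure (F.P K) K (Matrix.specialUnitaryGroup (Fin 2) ℂ)),
        (inputOfAC 𝔠.lane (h.pkgAt γ hγ hγ1 K).X (h.pkgAt γ hγ hγ1 K).𝔖).W.mass K r W ≤ ((K : ℝ) + 1) * Real.exp A₁) :
    ∃ CZ : ℝ, ∀ K : ℕ, ∀ᵐ W ∂fieldMeasure (F.P K) K (Matrix.specialUnitaryGroup (Fin 2) ℂ),
      (h.dataT3 γ hγ hγ1 π).LF K K W
          (fun hh => -((h.dataT3 γ hγ hγ1 π).mainT K K hh W) + (h.dataT3 γ hγ hγ1 π).Zterm K K hh) ≤ ((K : ℝ) + 1) * Real.exp CZ := by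
  obtain ⟨A₁, hA⟩ := hEnv
  refine ⟨A₁ + 3 / (Real.log F.L / 2) * (2 * (F.L : ℝ) ^ F.m) ^ 3, fun K => ?_⟩
  have hae : ∀ᵐ W ∂fieldMeasure (F.P K) K (Matrix.specialUnitaryGroup (Fin 2) ℂ), ∀ r : Hist (F.P K) K,
      (inputOfAC 𝔠.lane (h.pkgAt γ hγ hγ1 K).X (h.pkgAt γ hγ hγ1 K).𝔖).W.mass K r W ≤ ((K : ℝ) + 1) * Real.exp A₁ :=
    ae_all_iff.2 fun r => hA K r
  filter_upwards [hae] with W hW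
  have hK1 : (0 : ℝ) ≤ ((K : ℝ) + 1) * Real.exp A₁ := by positivity
  have h1 := top_le_of_massEnvelopeAll (h.pkgAt γ hγ hγ1 K) hK1 W (fun r _ => hW r)
  calc (h.dataT3 γ hγ hγ1 π).LF K K W
          (fun hh => -((h.dataT3 γ hγ hγ1 π).mainT K K hh W) + (h.dataT3 γ hγ hγ1 π).Zterm K K hh)
        = ∑ r : Hist (F.P K) K, (inputOfAC 𝔠.lane (h.pkgAt γ hγ hγ1 K).X (h.pkgAt γ hγ hγ1 K).𝔖).W.mass K r W *
            Real.exp (-((h.pkgAt γ hγ hγ1 K).T.mainT K r W) + (h.pkgAt γ hγ hγ1 K).T.Zterm K r) := rfl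
    _ ≤ ((K : ℝ) + 1) * Real.exp A₁ * Real.exp (3 / (Real.log F.L / 2) * (2 * (F.L : ℝ) ^ F.m) ^ 3) := h1
    _ = ((K : ℝ) + 1) * Real.exp (A₁ + 3 / (Real.log F.L / 2) * (2 * (F.L : ℝ) ^ F.m) ^ 3) := by
        rw [Real.exp_add]; ring

/-- ★★ **(U″) WITH LINEAR SLACK FROM THE LINEAR LEAF**: `LF_K ≤ (K+1)·e^{CZ}` a.e. (every run) ⇒ `∃ Cu', ∀ K, ρ_K ≤ (K+1)·exp(−Ecst_K + Cu')` `dV_K`-a.e. — K-22 §3's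
one-run reading ✓`ae_emlDensity_top_le_of_rows_ae_at` at `CZ + log(K+1)`, rows BY NAME ((41)′ ✓`dataT3_ineq41AE`, shape ✓`dataT3_lfShape`, remainder
✓`dataT3_exp_two_Rm_le` + `Rm_nonneg ∘ dataT3_rmSize`, (46) ✓`abs_dataT3_Pint_top_le`). [cite: Balaban1985UV3, (41) p.266, (46) p.267, (5) p.256, pp.273–274] -/
theorem _root_.Summit.QuantumFields.YangMills.Theorems.AlphaInputsT3AC.Of.ae_emlDensity_top_le_lin_of_hlfLin
    (hlfLin : ∃ CZ : ℝ, ∀ K : ℕ, ∀ᵐ W ∂fieldMeasure (F.P K) K (Matrix.specialUnitaryGroup (Fin 2) ℂ),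
      (h.dataT3 γ hγ hγ1 π).LF K K W
          (fun hh => -((h.dataT3 γ hγ hγ1 π).mainT K K hh W) + (h.dataT3 γ hγ hγ1 π).Zterm K K hh) ≤ ((K : ℝ) + 1) * Real.exp CZ) :
    ∃ Cu' : ℝ, ∀ K : ℕ, ∀ᵐ W ∂fieldMeasure (F.P K) K (Matrix.specialUnitaryGroup (Fin 2) ℂ),
      emlDensity F γ K K W ≤ ((K : ℝ) + 1) * Real.exp (-((h.dataT3 γ hγ hγ1 π).Ecst K K) + Cu') := by
  obtain ⟨CZ, hCZ⟩ := hlfLin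
  obtain ⟨CRm, hCRm⟩ := h.dataT3_exp_two_Rm_le γ hγ hγ1 π
  have hCRm0 : 0 < CRm := (Real.exp_pos _).trans_le (hCRm 0 0 le_rfl)
  have hRm : ∀ K : ℕ, (h.dataT3 γ hγ hγ1 π).Rm K K ≤ Real.log CRm := fun K => by
    have h2 : Real.exp (2 * (h.dataT3 γ hγ hγ1 π).Rm K K) ≤ CRm := hCRm K K le_rfl
    have h0 : 0 ≤ (h.dataT3 γ hγ hγ1 π).Rm K K := Rm_nonneg (h.dataT3_rmSize γ hγ hγ1 π) le_rfl
    have h1 : Real.exp ((h.dataT3 γ hγ hγ1 π).Rm K K) ≤ Real.exp (2 * (h.dataT3 γ hγ hγ1 π).Rm K K) :=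
      Real.exp_le_exp.mpr (by linarith)
    exact (Real.le_log_iff_exp_le hCRm0).mpr (h1.trans h2)
  refine ⟨Real.log CRm + 𝔠.C46 * (𝔠.M₁ : ℝ) ^ 3 * θBal F.L γ 𝔠.b₀ 𝔠.p₀ 1 ^ 2 * (2 * (F.L : ℝ) ^ F.m) ^ 3 + CZ, fun K => ?_⟩
  have hK1 : (0 : ℝ) < (K : ℝ) + 1 := by positivity
  have hlfK : ∀ᵐ W ∂fieldMeasure (F.P K) K (Matrix.specialUnitaryGroup (Fin 2) ℂ),
      (h.dataT3 γ hγ hγ1 π).LF K K W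
          (fun hh => -((h.dataT3 γ hγ hγ1 π).mainT K K hh W) + (h.dataT3 γ hγ hγ1 π).Zterm K K hh) ≤
        Real.exp (CZ + Real.log ((K : ℝ) + 1)) := by
    filter_upwards [hCZ K] with W hW
    rw [Real.exp_add, Real.exp_log hK1, mul_comm]
    exact hW
  have hat := ae_emlDensity_top_le_of_rows_ae_at (h.dataT3 γ hγ hγ1 π) K (h.dataT3_ineq41AE γ hγ hγ1 π K K le_rfl)
    (fun W Φ Ψ hle => (h.dataT3_lfShape γ hγ hγ1 π).1 K K W Φ Ψ hle)
    (fun W Φ t => (h.dataT3_lfShape γ hγ hγ1 π).2 K K W Φ t) (hRm K)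
    (fun hh W => (abs_le.mp (h.abs_dataT3_Pint_top_le γ hγ hγ1 π K hh W)).2) hlfK
  filter_upwards [hat] with W hW
  refine hW.trans (le_of_eq ?_)
  rw [show -((h.dataT3 γ hγ hγ1 π).Ecst K K) +
        (Real.log CRm + 𝔠.C46 * (𝔠.M₁ : ℝ) ^ 3 * θBal F.L γ 𝔠.b₀ 𝔠.p₀ 1 ^ 2 * (2 * (F.L : ℝ) ^ F.m) ^ 3 +
          (CZ + Real.log ((K : ℝ) + 1))) =
      (-((h.dataT3 γ hγ hγ1 π).Ecst K K) +
        (Real.log CRm + 𝔠.C46 * (𝔠.M₁ : ℝ) ^ 3 * θBal F.L γ 𝔠.b₀ 𝔠.p₀ 1 ^ 2 * (2 * (F.L : ℝ) ^ F.m) ^ 3 + CZ)) +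
        Real.log ((K : ℝ) + 1) by ring,
    Real.exp_add, Real.exp_log hK1, mul_comm]

/-- ★★ **THE UNIT ENVELOPE WITH LINEAR SLACK, PER `(F, γ)`, FROM THE (α) SOCKET, THE MAIN-TERM ROW AND THE LINEAR LEAF**: `∃ Cl', ∀ K, ρ_K ≤ (K+1)·e^{Cl'}·Z_K` a.e. —
`ae_emlDensity_top_le_lin_of_hlfLin` (upper) and ✓`AlphaInputsT3AC.Of.exp_Ecst_le_partitionFn_of_package_of_main (hMain)` (lower), knit by K-22 §4 ✓`unitEnvelope_of_halves_lin`.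
[cite: Balaban1985UV3, Thm 1 (5)–(6) pp.256–257, (41) p.266, (46)–(47) p.267, pp.273–274] -/
theorem _root_.Summit.QuantumFields.YangMills.Theorems.AlphaInputsT3AC.Of.unitEnvelopeLin_of_hlfLin_of_main
    (hlfLin : ∃ CZ : ℝ, ∀ K : ℕ, ∀ᵐ W ∂fieldMeasure (F.P K) K (Matrix.specialUnitaryGroup (Fin 2) ℂ),
      (h.dataT3 γ hγ hγ1 π).LF K K W
          (fun hh => -((h.dataT3 γ hγ hγ1 π).mainT K K hh W) + (h.dataT3 γ hγ hγ1 π).Zterm K K hh) ≤ ((K : ℝ) + 1) * Real.exp CZ)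
    (hMain : ∃ Cm : ℝ, ∀ (K : ℕ) (W : GaugeField (F.P K) K (Matrix.specialUnitaryGroup (Fin 2) ℂ)),
      PlaqSmall (θBal F.L γ 𝔠.b₀ 𝔠.p₀ 0) W →
        (h.dataT3 γ hγ hγ1 π).mainT K K ((h.dataT3 γ hγ hγ1 π).triv K K) W ≤ Cm) :
    ∃ Cl' : ℝ, ∀ K : ℕ, ∀ᵐ V ∂fieldMeasure (F.P K) K (Matrix.specialUnitaryGroup (Fin 2) ℂ),
      emlDensity F γ K K V ≤
        ((K : ℝ) + 1) * (Real.exp Cl' * partitionFn (G := Matrix.specialUnitaryGroup (Fin 2) ℂ) (F.P K) ((F.scheme ℰp γ).β K)) :=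
  unitEnvelope_of_halves_lin F hγ.le (fun K => (h.dataT3 γ hγ hγ1 π).Ecst K K)
    (h.ae_emlDensity_top_le_lin_of_hlfLin γ hγ hγ1 π hlfLin) (h.exp_Ecst_le_partitionFn_of_package_of_main γ hγ hγ1 π hMain)

/-- ★★★ **THE TOP-LEVEL UN-PINNED LEAF WITH LINEAR SLACK FROM hTop**: `∃ CZ, ∀ K, ∀ᵐ W, LF_K K W (−mainT+Zterm) ≤ (K+1)·exp CZ` — the parent file's
✓`AlphaInputsT3AC.Of.linMassEnvelope_all_of_topHaarPushforward` (EVERY history, the trivial one included: no hTriv row) into `hlfLin_of_linMassEnvelopeAll`.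
[cite: Balaban1985UV3, (41) p.266, (2) p.256, (5) p.257, pp.273–274; Balaban1987RG1, (0.11) p.253] -/
theorem _root_.Summit.QuantumFields.YangMills.Theorems.AlphaInputsT3AC.Of.hlfLin_of_topHaarPushforward
    (hTop : ∃ c : ℝ, 0 ≤ c ∧ ∀ (K j n : ℕ), j + n = K →
      (fieldMeasure (F.P K) j (Matrix.specialUnitaryGroup (Fin 2) ℂ)).map (iterFrom (avT3 F K) j n) ≤
        ENNReal.ofReal (Real.exp c) • fieldMeasure (F.P K) (j + n) (Matrix.specialUnitaryGroup (Fin 2) ℂ)) :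
    ∃ CZ : ℝ, ∀ K : ℕ, ∀ᵐ W ∂fieldMeasure (F.P K) K (Matrix.specialUnitaryGroup (Fin 2) ℂ),
      (h.dataT3 γ hγ hγ1 π).LF K K W
          (fun hh => -((h.dataT3 γ hγ hγ1 π).mainT K K hh W) + (h.dataT3 γ hγ hγ1 π).Zterm K K hh) ≤ ((K : ℝ) + 1) * Real.exp CZ := by
  obtain ⟨A₁, -, hA⟩ := h.linMassEnvelope_all_of_topHaarPushforward γ hγ hγ1 hTop
  exact h.hlfLin_of_linMassEnvelopeAll γ hγ hγ1 π ⟨A₁, hA⟩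

/-- ★★★ **THE UNIT ENVELOPE WITH LINEAR SLACK, PER `(F, γ)`, FROM THE (α) SOCKET, THE MAIN-TERM ROW AND hTop**: `∃ Cl', ∀ K, ρ_K ≤ (K+1)·e^{Cl'}·Z_K` a.e.
The registered `stub_unitEnvelope` is the same letter WITHOUT the factor `K + 1`; the history-tail door absorbs the factor at the constrained heights (§2).
[cite: Balaban1985UV3, Thm 1 (5)–(6) pp.256–257, (41) p.266, (46)–(47) p.267, pp.273–274; Balaban1987RG1, (0.11) p.253] -/
theorem _root_.Summit.QuantumFields.YangMills.Theorems.AlphaInputsT3AC.Of.unitEnvelopeLin_of_topHaarPushforward_of_main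
    (hTop : ∃ c : ℝ, 0 ≤ c ∧ ∀ (K j n : ℕ), j + n = K →
      (fieldMeasure (F.P K) j (Matrix.specialUnitaryGroup (Fin 2) ℂ)).map (iterFrom (avT3 F K) j n) ≤
        ENNReal.ofReal (Real.exp c) • fieldMeasure (F.P K) (j + n) (Matrix.specialUnitaryGroup (Fin 2) ℂ))
    (hMain : ∃ Cm : ℝ, ∀ (K : ℕ) (W : GaugeField (F.P K) K (Matrix.specialUnitaryGroup (Fin 2) ℂ)),
      PlaqSmall (θBal F.L γ 𝔠.b₀ 𝔠.p₀ 0) W →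
        (h.dataT3 γ hγ hγ1 π).mainT K K ((h.dataT3 γ hγ hγ1 π).triv K K) W ≤ Cm) :
    ∃ Cl' : ℝ, ∀ K : ℕ, ∀ᵐ V ∂fieldMeasure (F.P K) K (Matrix.specialUnitaryGroup (Fin 2) ℂ),
      emlDensity F γ K K V ≤
        ((K : ℝ) + 1) * (Real.exp Cl' * partitionFn (G := Matrix.specialUnitaryGroup (Fin 2) ℂ) (F.P K) ((F.scheme ℰp γ).β K)) :=
  h.unitEnvelopeLin_of_hlfLin_of_main γ hγ hγ1 π (h.hlfLin_of_topHaarPushforward γ hγ hγ1 π hTop) hMain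

end PerFamily

/-! ## §2 The `∀ L` letters with the guarded socket, the pinned height tail, and the crux by name -/

/-- **THE LETTER WITH `blockAvg ℰp` SPELLED OUT IMPLIES hTop** (per family): in range `j + n = K ≤ m + K` the composite of the pinned family IS the iterated block
averaging (parent file's ✓`iterFrom_avT3_eq_iterFrom_blockAvg`). [cite: Balaban1987RG1, (0.4) + (0.11) p.253] -/
theorem topHaarPushforward_of_topBlockAvgPushforward (F : T3Family)
    (hTopB : ∃ c : ℝ, 0 ≤ c ∧ ∀ (K j n : ℕ), j + n = K →
      (fieldMeasure (F.P K) j (Matrix.specialUnitaryGroup (Fin 2) ℂ)).map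
          (iterFrom (fun i => BlockAveraging.blockAvg (P := F.P K) (G := Matrix.specialUnitaryGroup (Fin 2) ℂ) (j := i) ℰp) j n) ≤
        ENNReal.ofReal (Real.exp c) • fieldMeasure (F.P K) (j + n) (Matrix.specialUnitaryGroup (Fin 2) ℂ)) :
    ∃ c : ℝ, 0 ≤ c ∧ ∀ (K j n : ℕ), j + n = K →
      (fieldMeasure (F.P K) j (Matrix.specialUnitaryGroup (Fin 2) ℂ)).map (iterFrom (avT3 F K) j n) ≤
        ENNReal.ofReal (Real.exp c) • fieldMeasure (F.P K) (j + n) (Matrix.specialUnitaryGroup (Fin 2) ℂ) := by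
  obtain ⟨c, hc0, hc⟩ := hTopB
  refine ⟨c, hc0, fun K j n hjn => ?_⟩
  rw [iterFrom_avT3_eq_iterFrom_blockAvg F K j n (by omega)]
  exact hc K j n hjn

/-- ★★ **THE `∀ L` UNIT-ENVELOPE LETTER WITH LINEAR SLACK FROM THE GUARDED SOCKET, `π`, `hMain`, hTop** — §1 family by family at the socket's record for the block size
(threshold `γ₁ := (min γ₀ 1)²`); `L ≤ 1` vacuous (no three-torus family has such a block size, `T3Family.hL`), as in `ym-ust-19936-w8` g11's guarded twins.
[cite: Balaban1985UV3, Thm 1 (5)–(6) pp.256–257, (41) p.266, (46)–(47) p.267] -/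
theorem unitEnvelopeLin_forall_of_topHaarPushforward_of_main (π : ∀ F : T3Family, AlphaInputsT3AC.PolymerT3 F)
    (hpkg : ∀ L : ℕ, 1 < L → AlphaInputsT3AC L)
    (hMain : ∀ (F : T3Family) (𝔠 : AlphaConsts F.L (suGroupModel 2).N) (h : AlphaInputsT3AC.Of F 𝔠) (γ : ℝ) (hγ : 0 < γ)
      (hγ1 : γ ≤ (min 𝔠.gamma0 1) ^ 2), ∃ Cm : ℝ, ∀ (K : ℕ) (W : GaugeField (F.P K) K (Matrix.specialUnitaryGroup (Fin 2) ℂ)),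
        PlaqSmall (θBal F.L γ 𝔠.b₀ 𝔠.p₀ 0) W →
          (h.dataT3 γ hγ hγ1 (π F)).mainT K K ((h.dataT3 γ hγ hγ1 (π F)).triv K K) W ≤ Cm)
    (hTop : ∀ F : T3Family, ∃ c : ℝ, 0 ≤ c ∧ ∀ (K j n : ℕ), j + n = K →
      (fieldMeasure (F.P K) j (Matrix.specialUnitaryGroup (Fin 2) ℂ)).map (iterFrom (avT3 F K) j n) ≤
        ENNReal.ofReal (Real.exp c) • fieldMeasure (F.P K) (j + n) (Matrix.specialUnitaryGroup (Fin 2) ℂ)) :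
    ∀ (L : ℕ), ∃ γ₁ : ℝ, 0 < γ₁ ∧ ∀ (F : T3Family) (γ : ℝ), F.L = L → 0 < γ → γ ≤ γ₁ →
      ∃ Cl : ℝ, ∀ K : ℕ, ∀ᵐ V ∂(fieldMeasure (F.P K) K (Matrix.specialUnitaryGroup (Fin 2) ℂ)),
        emlDensity F γ K K V ≤
          ((K : ℝ) + 1) * (Real.exp Cl * partitionFn (G := Matrix.specialUnitaryGroup (Fin 2) ℂ) (F.P K) ((F.scheme ℰp γ).β K)) := by
  intro L
  by_cases hL : 1 < L
  · obtain ⟨𝔠, h𝔠⟩ := hpkg L hL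
    refine ⟨(min 𝔠.gamma0 1) ^ 2, pow_pos (lt_min 𝔠.gamma0_pos one_pos) 2, fun F γ hFL hγ hγle => ?_⟩
    subst hFL
    exact (h𝔠 F rfl).unitEnvelopeLin_of_topHaarPushforward_of_main γ hγ hγle (π F) (hTop F) (hMain F 𝔠 (h𝔠 F rfl) γ hγ hγle)
  · -- no three-torus family has block size `L ≤ 1`
    exact ⟨1, one_pos, fun F γ hFL _ _ => absurd (hFL ▸ F.hL.2) hL⟩

/-- ★★★ **THE PINNED HEIGHT TAIL `hP′` (the LEAD's K-19′ socket hypothesis, VERBATIM) FROM THE GUARDED SOCKET, `π`, `hMain` AND hTop.**  S side: `ym-ust-19936-w8` g11's guarded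
S-face ✓`stub_pinnedStepV3_of_package_of_purePinTop_of_main' (hpkg)(π)(hMain)(hPinA)` with `hPinA` from the S-KNIT ✓`hPinA_of_pinnedLF (π)(hSii)` and `hSii` from the KNIT
✓`hSii_forall_of_topHaarPushforward (hTop)`; U side: `unitEnvelopeLin_forall_of_topHaarPushforward_of_main`; door: LEAD K-23 ✓`pinnedHeightTail_of_lin'` (the factor `K + 1`
absorbed by `K + 1 ≤ (m+2)·β_{K−j}` at the constrained heights). [cite: Balaban1985UV3, Thm 1 (5) p.256, (2) p.256, (6)–(7) p.257, (41) p.266, (47) p.267, (67)–(71) p.273; Balaban1987RG1, (0.11) p.253] -/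
theorem pinnedHeightTail_of_package_of_topHaarPushforward_of_main
    (hpkg : ∀ L : ℕ, 1 < L → AlphaInputsT3AC L)
    (π : ∀ F : T3Family, AlphaInputsT3AC.PolymerT3 F)
    (hMain : ∀ (F : T3Family) (𝔠 : AlphaConsts F.L (suGroupModel 2).N) (h : AlphaInputsT3AC.Of F 𝔠) (γ : ℝ) (hγ : 0 < γ)
      (hγ1 : γ ≤ (min 𝔠.gamma0 1) ^ 2), ∃ Cm : ℝ, ∀ (K : ℕ) (W : GaugeField (F.P K) K (Matrix.specialUnitaryGroup (Fin 2) ℂ)),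
        PlaqSmall (θBal F.L γ 𝔠.b₀ 𝔠.p₀ 0) W →
          (h.dataT3 γ hγ hγ1 (π F)).mainT K K ((h.dataT3 γ hγ hγ1 (π F)).triv K K) W ≤ Cm)
    (hTop : ∀ F : T3Family, ∃ c : ℝ, 0 ≤ c ∧ ∀ (K j n : ℕ), j + n = K →
      (fieldMeasure (F.P K) j (Matrix.specialUnitaryGroup (Fin 2) ℂ)).map (iterFrom (avT3 F K) j n) ≤
        ENNReal.ofReal (Real.exp c) • fieldMeasure (F.P K) (j + n) (Matrix.specialUnitaryGroup (Fin 2) ℂ)) :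
    ∀ (L : ℕ), ∃ (b₁' p₁' : ℝ), ∀ (b₀ p₀ : ℝ), b₁' ≤ b₀ → p₁' ≤ p₀ → 0 < b₀ → 2 < p₀ → ∀ (m : ℕ), 0 < m →
      ∃ γ₁ : ℝ, 0 < γ₁ ∧ γ₁ ≤ 1 ∧ ∀ (F : T3Family) (γ : ℝ), F.L = L → 0 < γ → γ ≤ γ₁ →
        ∃ (b p C c : ℝ) (A : ℕ), 0 < b ∧ 1 ≤ p ∧ 0 ≤ C ∧ 0 < c ∧
          ∀ (K j : ℕ), 1 ≤ j → j + 2 ≤ K → j + (K - 1) / m ≤ K → ∀ a : Plaq (F.P K) j,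
          (gibbsK F ℰp γ K).real
              ({U : GaugeField (F.P K) 0 (Matrix.specialUnitaryGroup (Fin 2) ℂ) |
                  θBal F.L γ b₀ p₀ (K - j) ≤ GaugeGroup.dist1 (GaugeField.plaqHol
                    (Averaging.iter (fun i' => BlockAveraging.blockAvg (P := F.P K) (j := i') ℰp) j U) a)} ∩
                {U : GaugeField (F.P K) 0 (Matrix.specialUnitaryGroup (Fin 2) ℂ) | ∀ i, i < j →
                  PlaqSmall (θBal F.L γ b₀ p₀ (K - i))
                    (Averaging.iter (fun i' => BlockAveraging.blockAvg (P := F.P K) (j := i') ℰp) i U)}) ≤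
            C * (F.scheme ℰp γ).β (K - j) ^ A *
              Real.exp (-(c * B10.pFun b p (Real.sqrt (γ * ((F.L : ℝ)⁻¹) ^ (K - j))) ^ 2)) :=
  pinnedHeightTail_of_lin'
    (stub_pinnedStepV3_of_package_of_purePinTop_of_main' hpkg π hMain
      (hPinA_of_pinnedLF π (hSii_forall_of_topHaarPushforward hTop)))
    (unitEnvelopeLin_forall_of_topHaarPushforward_of_main π hpkg hMain hTop)

/-- ★★★★ **`UnitScaleTilt.HistoryTailL` (stmt-QuantumFields-19936) FROM THE GUARDED v1 (α) SOCKET, THE POLYMER FIELDS, THE MAIN-TERM ROW AND hTop** — the v5-candidate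
face (★★OWNER WORD 68): `pinnedHeightTail_of_package_of_topHaarPushforward_of_main` through the LEAD socket ✓p748552 `historyTailL_of_pinnedHeightTail_freeRate`, one `exact`.
FOUR displayed rows: `hpkg` (the UV3 node's (α) input package, XXL, lane pub-balaban3d; guarded per №38), `π` (a parameter), `hMain` (EX lane), hTop (Haar pushed through the
`K`-fold block averaging ONTO THE UNIT TORUS has density `≤ e^{c}`, `c` uniform in `K` — the N08 loop part, OPEN for `blockAvg ℰp`).  CONDITIONAL: closes nothing.
R3 = YM₃ on T³, a rung — NOT d = 4, NOT infinite volume, NOT a mass gap, NOT Clay.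
[cite: Balaban1985UV3, Thm 1 (5) p.256, (2) p.256, (41) p.266, (47) p.267, (67)–(71) p.273; Balaban1985Averaging, (15) p.19; Balaban1987RG1, (0.11) p.253] -/
theorem historyTailL_of_package_of_topHaarPushforward_of_main
    (hpkg : ∀ L : ℕ, 1 < L → AlphaInputsT3AC L)
    (π : ∀ F : T3Family, AlphaInputsT3AC.PolymerT3 F)
    (hMain : ∀ (F : T3Family) (𝔠 : AlphaConsts F.L (suGroupModel 2).N) (h : AlphaInputsT3AC.Of F 𝔠) (γ : ℝ) (hγ : 0 < γ)
      (hγ1 : γ ≤ (min 𝔠.gamma0 1) ^ 2), ∃ Cm : ℝ, ∀ (K : ℕ) (W : GaugeField (F.P K) K (Matrix.specialUnitaryGroup (Fin 2) ℂ)),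
        PlaqSmall (θBal F.L γ 𝔠.b₀ 𝔠.p₀ 0) W →
          (h.dataT3 γ hγ hγ1 (π F)).mainT K K ((h.dataT3 γ hγ hγ1 (π F)).triv K K) W ≤ Cm)
    (hTop : ∀ F : T3Family, ∃ c : ℝ, 0 ≤ c ∧ ∀ (K j n : ℕ), j + n = K →
      (fieldMeasure (F.P K) j (Matrix.specialUnitaryGroup (Fin 2) ℂ)).map (iterFrom (avT3 F K) j n) ≤
        ENNReal.ofReal (Real.exp c) • fieldMeasure (F.P K) (j + n) (Matrix.specialUnitaryGroup (Fin 2) ℂ)) :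
    Summit.QuantumFields.YangMills.Theses.UnitScaleTilt.HistoryTailL :=
  historyTailL_of_pinnedHeightTail_freeRate (pinnedHeightTail_of_package_of_topHaarPushforward_of_main hpkg π hMain hTop)

/-- ★★★ **`UnitScaleTilt.HistoryTailL` FROM THE GUARDED SOCKET, `π`, `hMain` AND THE TOP-LEVEL LETTER WITH THE CRUXES' `blockAvg ℰp` FAMILY SPELLED OUT** — «for every
three-torus family there is `c ≥ 0` such that, at every run `K`, every segment `Ū_{K−1}∘⋯∘Ū_j` of the iterated block averaging `blockAvg ℰp` ending at the unit torus pushes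
Haar to at most `e^{c}`·Haar» (`topHaarPushforward_of_topBlockAvgPushforward`, then the face above).
[cite: Balaban1985UV3, Thm 1 (5) p.256, (2) p.256, (41) p.266; Balaban1987RG1, (0.4) + (0.11) p.253] -/
theorem historyTailL_of_package_of_topBlockAvgPushforward_of_main
    (hpkg : ∀ L : ℕ, 1 < L → AlphaInputsT3AC L)
    (π : ∀ F : T3Family, AlphaInputsT3AC.PolymerT3 F)
    (hMain : ∀ (F : T3Family) (𝔠 : AlphaConsts F.L (suGroupModel 2).N) (h : AlphaInputsT3AC.Of F 𝔠) (γ : ℝ) (hγ : 0 < γ)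
      (hγ1 : γ ≤ (min 𝔠.gamma0 1) ^ 2), ∃ Cm : ℝ, ∀ (K : ℕ) (W : GaugeField (F.P K) K (Matrix.specialUnitaryGroup (Fin 2) ℂ)),
        PlaqSmall (θBal F.L γ 𝔠.b₀ 𝔠.p₀ 0) W →
          (h.dataT3 γ hγ hγ1 (π F)).mainT K K ((h.dataT3 γ hγ hγ1 (π F)).triv K K) W ≤ Cm)
    (hTopB : ∀ F : T3Family, ∃ c : ℝ, 0 ≤ c ∧ ∀ (K j n : ℕ), j + n = K →
      (fieldMeasure (F.P K) j (Matrix.specialUnitaryGroup (Fin 2) ℂ)).map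
          (iterFrom (fun i => BlockAveraging.blockAvg (P := F.P K) (G := Matrix.specialUnitaryGroup (Fin 2) ℂ) (j := i) ℰp) j n) ≤
        ENNReal.ofReal (Real.exp c) • fieldMeasure (F.P K) (j + n) (Matrix.specialUnitaryGroup (Fin 2) ℂ)) :
    Summit.QuantumFields.YangMills.Theses.UnitScaleTilt.HistoryTailL :=
  historyTailL_of_package_of_topHaarPushforward_of_main hpkg π hMain fun F => topHaarPushforward_of_topBlockAvgPushforward F (hTopB F)

end Summit.QuantumFields.YangMills.Theorems.UnitScaleTiltHistoryTailOfPackageTopPartialIterates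

end
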